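import Literature.Barriers.RiemannHypothesis.EpsteinZetaRealZerosDHHolds

/-!
# `ExactFirstBand` (crux stmt-RiemannHypothesis-2061, route RuelleBand) — the side-condition-free shape fails for `ζ_{x²+5y²}`

Negative-side support file of the crux disprover (cdisprove seat, cycle 1), companion of `ModelShapes.lean`.
For `ζ` the crux X is equivalent to its side-condition-free forms "every zero with `re s > 1/2` is real" and
"every zero is critical or real" (file `LoadBearing`: `exactFirstBand_iff_rightZerosReal`,
`exactFirstBand_iff_allZeros` — the reduction uses the Euler product at `σ ≥ 1`). Both forms are FALSE for the
Epstein zeta function of `x² + 5y²` (class number `h(-20) = 2`): Davenport–Heilbronn 1936 (tree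
`DavenportHeilbronn1936b_epstein_holds`, PROVED) gives a non-real zero in the half-plane of ABSOLUTE CONVERGENCE
`σ > 1`, where `epsteinZeta` is the genuine double series. The two arithmetic side conditions of that theorem are
discharged here for `d = -20` (`twoFormClasses_neg_twenty`, `isFundamentalDiscriminant_neg_twenty`).
-/

noncomputable section

open Complex Set Filter Topology

namespace Summit.RiemannHypothesis.Cruxes.ExactFirstBand.Negative

open Literature.Barriers.RiemannHypothesis

/-- `h(-20) = 2` in the tree's vocabulary: `x² + 5y²` and `2x² + 2xy + 3y²` have discriminant `-20` and are not
properly equivalent (`2 = p² + 5r²` has no integer solution). [folklore] -/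
theorem twoFormClasses_neg_twenty : TwoFormClasses (-20) := by
  refine ⟨(1, 0, 5), (2, 2, 3), by norm_num, by norm_num, by decide, by decide, ?_⟩
  rintro ⟨p, q, r, s, -, h1, -, -⟩
  have h1' : p ^ 2 + 5 * r ^ 2 = 2 := by simp only at h1; linarith
  have hr0 : r ≤ 0 := by nlinarith [sq_nonneg p, sq_nonneg (r - 1)]
  have hr1 : 0 ≤ r := by nlinarith [sq_nonneg p, sq_nonneg (r + 1)]
  have hr : r = 0 := le_antisymm hr0 hr1
  subst hr
  have hp0 : p ≤ 1 := by nlinarith [sq_nonneg (p - 2)]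
  have hp1 : -1 ≤ p := by nlinarith [sq_nonneg (p + 2)]
  interval_cases p <;> norm_num at h1'

/-- `-20 = 4·(-5)` is a fundamental discriminant. [folklore] -/
theorem isFundamentalDiscriminant_neg_twenty : IsFundamentalDiscriminant (-20) :=
  Or.inr ⟨by decide, by decide, by
    have h : Prime (5 : ℤ) := Int.prime_iff_natAbs_prime.2 (by norm_num)
    simpa using (Prime.neg h).squarefree⟩

/-- A GENUINE non-real zero of `ζ_Q`, `Q = x² + 5y²` (`h(-20) = 2`), in the half-plane of ABSOLUTE CONVERGENCE
`σ > 1` (where `epsteinZeta` is the convergent double series; no continuation or junk value is involved):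
Davenport–Heilbronn 1936 (tree `DavenportHeilbronn1936b_epstein_holds`, PROVED; `≥ C·T` such zeros with
`0 < t ≤ T`). [cite: Titchmarsh1986, §10.27] [cite: DavenportHeilbronn1936b, §6 Theorem] -/
theorem exists_epstein_zero_right : ∃ s : ℂ, 1 < s.re ∧ 0 < s.im ∧ epsteinZeta 1 0 5 s = 0 := by
  have hQ : IsPosDefForm ((1 : ℤ) : ℝ) ((0 : ℤ) : ℝ) ((5 : ℤ) : ℝ) := ⟨by norm_num, by norm_num⟩
  have hd : IsFundamentalDiscriminant ((0 : ℤ) ^ 2 - 4 * 1 * 5) := by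
    rw [show (0 : ℤ) ^ 2 - 4 * 1 * 5 = -20 by norm_num]; exact isFundamentalDiscriminant_neg_twenty
  have h2 : TwoFormClasses ((0 : ℤ) ^ 2 - 4 * 1 * 5) := by
    rw [show (0 : ℤ) ^ 2 - 4 * 1 * 5 = -20 by norm_num]; exact twoFormClasses_neg_twenty
  obtain ⟨-, C, hC, hev⟩ := DavenportHeilbronn1936b_epstein_holds 1 0 5 hQ hd h2
  obtain ⟨T, hT, hT1⟩ := (hev.and (eventually_ge_atTop 1)).exists
  have hpos : (0 : ℝ) < ({s : ℂ | 1 < s.re ∧ 0 < s.im ∧ s.im ≤ T ∧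
      epsteinZeta ((1 : ℤ) : ℝ) ((0 : ℤ) : ℝ) ((5 : ℤ) : ℝ) s = 0}.ncard : ℝ) :=
    lt_of_lt_of_le (by nlinarith) hT
  have hne : {s : ℂ | 1 < s.re ∧ 0 < s.im ∧ s.im ≤ T ∧
      epsteinZeta ((1 : ℤ) : ℝ) ((0 : ℤ) : ℝ) ((5 : ℤ) : ℝ) s = 0}.Nonempty :=
    Set.nonempty_of_ncard_ne_zero (by exact_mod_cast hpos.ne')
  obtain ⟨s, hs1, hs2, -, hs4⟩ := hne
  exact ⟨s, hs1, hs2, by simpa using hs4⟩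

/-- MODEL KILL 2 (the side-condition-free forms of X): "every zero with `σ > 1/2` is real" FAILS for
`ζ_{x²+5y²}` — by a zero in `σ > 1`, i.e. exactly where the Euler product empties the picture for `ζ`.
[cite: Titchmarsh1986, §10.27] -/
theorem not_rightZerosReal_epstein : ¬ ∀ s : ℂ, epsteinZeta 1 0 5 s = 0 → 1 / 2 < s.re → s.im = 0 := by
  intro h
  obtain ⟨s, hs1, hs2, hs0⟩ := exists_epstein_zero_right
  exact absurd (h s hs0 (by linarith)) hs2.ne'

/-- "Every zero of `ζ_{x²+5y²}` is critical or real" FAILS. [cite: Titchmarsh1986, §10.27] -/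
theorem not_allZerosCriticalOrReal_epstein :
    ¬ ∀ s : ℂ, epsteinZeta 1 0 5 s = 0 → s.re = 1 / 2 ∨ s.im = 0 := by
  intro h
  obtain ⟨s, hs1, hs2, hs0⟩ := exists_epstein_zero_right
  rcases h s hs0 with h' | h'
  · linarith
  · exact hs2.ne' h'

end Summit.RiemannHypothesis.Cruxes.ExactFirstBand.Negative

end
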